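import Literature.NumberTheory.Automorphic.OrbitalMeasureCanonicalExists
import Literature.NumberTheory.Automorphic.CompactCoreCentralizerUnitary
import Literature.NumberTheory.Automorphic.LocalEndoscopicOrbitClosed
import Literature.NumberTheory.Rogawski1990.LocalTransferSplitPlaceClasses
import HarnessLib

/-!
# Canonical orbital measure families EXIST on the CM carriers: `U(H′)(L⁺_v)` and `H_v = U(Φ₂)(L⁺_v) × U(Φ₁)(L⁺_v)` at every finite place
(Rogawski (1990), §4.3 (4.3.1) p. 43 «compatible measures on `H_{γ′}` and `G_γ`», §4.9 Prop. 4.9.1 (a) p. 55; Tits (1979), §3.9; Platonov–Rapinchuk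
(1994), §5.1)

Topic `NumberTheory/Automorphic`; namespaces `Literature.NumberTheory.Automorphic.UnitaryGroup` (§1, the matrix carriers `«local» E c N J v`) and
`Literature.NumberTheory.Rogawski1990` (§2, the `cmDatum` carriers of the letters). THEOREMS ONLY (no definition, no instance, no notation, no named fact, no
`sorry`). Cell `pub/hodgecm-mathlib`, programme P3a, road «D-N6s», brick «D-N6s-cf DOCKING» (LEAD F0P3a-plan (g8) T7-71) over ★ `OrbitalMeasureCanonicalExists`
(F0P3a-p08: the producer `OrbitalMeasureFamily.exists_isCanonical (P) (ν) (ht)`) and ★ `CompactCoreCentralizerUnitary` (A-p03 «g0-U»: the `∃ t` clause of ★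
`OrbitalMeasureFamily.IsCanonical` on `U(J)(F_v)` at split ∕ non-split places, and on products). WHY: the N6 letter ★ `LocalTransferExplicit`
(`Rogawski1990/LocalTransferUnitExplicitFactor` :82) is `∀ v, ∃ mH mG, (mH.IsCanonical (IsLocalGRegular L v) (νH v) ∧ mG.IsCanonical (fun γ => IsRegularElt γ.val) (νG v)) ∧ …`;
the transfer clause is paid for GIVEN canonical `(mH, mG)` (B5-A, (J5)); this file produces the witnesses:

* §1 `U(J)(F_v) = «local» E c N J v` (`J` `c`-hermitian with unit determinant), for `γ` regular semisimple in `GL_N(E ⊗_F F_v)` (★ `IsRegularElt`: separable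
  characteristic polynomial over `∏_{w∣v} E_w`): the place-type dispatch (`PlacesOver.nonempty`, `c • w = w` or not) of A-p03's heads with the regularity
  BRIDGES (split: ★ `isRegularElt_localSplitEquiv_of_isRegularElt`; non-split: the one-place image is the `w`-component, `Matrix.charpoly_map`,
  `Polynomial.Separable.map`, `charpoly_separable_localNonsplitEquiv_of_isRegularElt`) — **`compactCore_centralizer_local_facts_of_isRegularElt`** (`Z(γ)`
  commutative, `compactCore Z(γ)` compact and open, place-type free) and **`forall_isRegularElt_exists_isHaarMeasure_compactCore_centralizer_local_eq_one`** (the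
  `ht` input of ★ `exists_isCanonical`, via ★ `exists_isHaarMeasure_compactCore_eq_one`); and `isRegularElt_of_fin_one` (every element of `GL₁` is regular
  semisimple).
* §2 the CM producers at a finite place `v` of `L⁺` (carriers and predicates of ★ `LocalTransferExplicit` VERBATIM):
  **`exists_isCanonical_cmDatum_local`** (`G′_v = (cmDatum L 3 H′).Local v`, `P := fun γ => IsRegularElt γ.val`),
  **`exists_isCanonical_H_local`** (`H_v = (cmDatum L 2 Φ₂).Local v × (cmDatum L 1 Φ₁).Local v`, `P := IsLocalGRegular L v`; ★ `coe_endoEmbLocal` + ★ `charpoly_endoGL`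
  + §1 on both factors + ★ `exists_isHaarMeasure_compactCore_centralizer_prod_eq_one`), and the pair **`exists_isCanonical_pair`** = the `∃`-prefix of the
  letter, for `obtain ⟨mH, mG, hmH, hmG⟩`.
HONEST LABEL: book-keeping over ★ files; HC_CM is proved only modulo the printed citations until rung 0 closes; no count moves. Archimedean places are out of
scope (★ `OrbitalMeasureCanonical` :131).

## References
* [Rogawski1990] J. D. Rogawski, *Automorphic Representations of Unitary Groups in Three Variables*, Ann. of Math. Stud. 123 (1990), §4.3 (4.3.1) p. 43,
  §4.9 Prop. 4.9.1 (a) p. 55, §3.1 p. 19.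
* [Tits1979] J. Tits, *Reductive groups over local fields*, Proc. Sympos. Pure Math. 33.1 (1979), §3.9.
* [PlatonovRapinchuk1994] V. Platonov, A. Rapinchuk, *Algebraic Groups and Number Theory* (1994), §5.1.
* [DeitmarEchterhoff2014] A. Deitmar, S. Echterhoff, *Principles of Harmonic Analysis*, 2nd ed. (2014), Thm. 1.5.3.
-/

set_option autoImplicit false

noncomputable section

open MeasureTheory Measure Set Filter Topology NumberField IsDedekindDomain
open Literature.MeasureTheory.Group
open scoped ENNReal NNReal Matrix MatrixGroups

/-! ## §1 `U(J)(F_v)`: the place-type dispatch with the regularity bridges -/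

namespace Literature.NumberTheory.Automorphic.UnitaryGroup

open Literature.NumberTheory.Rogawski1990 (IsRegularElt isRegularElt_iff)

section Local

variable {F E : Type} [Field F] [NumberField F] [Field E] [NumberField E] [Algebra F E] [Algebra.IsQuadraticExtension F E]
  (c : E ≃ₐ[F] E) (N : ℕ) (J : Matrix (Fin N) (Fin N) E) {v : HeightOneSpectrum (𝓞 F)} (hc : c ≠ 1)
  (hJ : (J.map c)ᵀ = J) (hJd : IsUnit J.det) (γ : «local» E c N J v) (hγ : IsRegularElt (γ : GL (Fin N) (LocalRing E v)))

/-- Non-split bridge: the one-place image `e γ ∈ U(σ_w, J_w)(E_w) ≤ GL_N(E_w)` of a regular semisimple `γ ∈ U(J)(F_v)` is regular semisimple (its matrix is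
the `w`-component of that of `γ`, ★ `coe_localPiNonsplitEquiv_apply`; `Matrix.charpoly_map`, `Polynomial.Separable.map`). [cite: Rogawski1990, §3.1 p. 19]
[cite: PlatonovRapinchuk1994, §5.1] -/
theorem charpoly_separable_localNonsplitEquiv_of_isRegularElt (w : PlacesOver E v) (hw : c • w.1 = w.1)
    (hγ : IsRegularElt (γ : GL (Fin N) (LocalRing E v))) :
    ((((localNonsplitEquiv c J hc w hw γ : unitaryGroupOfForm (galAdicCompletionMap (L := E) c hw) (placeForm J w.1)) :
        GL (Fin N) (w.1.adicCompletion E)) : Matrix (Fin N) (Fin N) (w.1.adicCompletion E)).charpoly).Separable := by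
  have h : (((localNonsplitEquiv c J hc w hw γ : unitaryGroupOfForm (galAdicCompletionMap (L := E) c hw) (placeForm J w.1)) :
        GL (Fin N) (w.1.adicCompletion E)) : Matrix (Fin N) (Fin N) (w.1.adicCompletion E)) =
      ((γ : GL (Fin N) (LocalRing E v)) : Matrix (Fin N) (Fin N) (LocalRing E v)).map
        (Pi.evalRingHom (fun w' : PlacesOver E v => w'.1.adicCompletion E) w) := rfl
  rw [h, Matrix.charpoly_map]
  exact hγ.map

include hc hJ hJd hγ in
/-- **The three compact-core facts for `Z(γ) ≤ U(J)(F_v)` at EVERY finite place** (`J` `c`-hermitian with unit determinant, `γ` regular semisimple in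
`GL_N(E ⊗_F F_v)`): `Z(γ)` is commutative, and `compactCore Z(γ)` is compact and open — A-p03's split ∕ non-split heads (★ `isCompact_compactCore_centralizer_local_of_split`,
`…_of_nonsplit`, `isOpen_…`, ★ `mul_comm_centralizer_of_isClosedEmbedding_gl` along ★ `localSplitEquiv` ∕ ★ `localNonsplitEquiv`) dispatched on the place type
(`c • w = w` or not, `w` any place over `v`) with the regularity bridges (split: ★ `isRegularElt_localSplitEquiv_of_isRegularElt`; non-split:
`charpoly_separable_localNonsplitEquiv_of_isRegularElt`). [cite: Tits1979, §3.9] [cite: PlatonovRapinchuk1994, §5.1] -/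
theorem compactCore_centralizer_local_facts_of_isRegularElt :
    (∀ a b : Subgroup.centralizer ({γ} : Set («local» E c N J v)), a * b = b * a) ∧
      IsCompact (compactCore (Subgroup.centralizer ({γ} : Set («local» E c N J v)))) ∧
        IsOpen (compactCore (Subgroup.centralizer ({γ} : Set («local» E c N J v)))) := by
  obtain ⟨w⟩ := (inferInstance : Nonempty (PlacesOver E v))
  by_cases hw : c • w.1 = w.1
  · have hγ' := charpoly_separable_localNonsplitEquiv_of_isRegularElt c N J hc γ w hw hγ
    exact ⟨mul_comm_centralizer_of_isClosedEmbedding_gl w.1 _ (isClosedEmbedding_subtype_comp_localNonsplitEquiv c N J hc w hw) γ hγ',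
      isCompact_compactCore_centralizer_local_of_nonsplit c N J hc w hw γ hγ',
      isOpen_compactCore_centralizer_local_of_nonsplit c N J hc w hw γ hγ'⟩
  · have hJw := isUnit_placeForm_of_isUnit_det hJd w.1
    have hγ' := (isRegularElt_iff _).1 (isRegularElt_localSplitEquiv_of_isRegularElt c w J hc hw hJ hJw γ hγ)
    exact ⟨mul_comm_centralizer_of_isClosedEmbedding_gl w.1 (localSplitEquiv c J hc hJ w hw hJw).toMonoidHom
        (localSplitEquiv c J hc hJ w hw hJw).toHomeomorph.isClosedEmbedding γ hγ',
      isCompact_compactCore_centralizer_local_of_split c N J hc hJ w hw hJw γ hγ',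
      isOpen_compactCore_centralizer_local_of_split c N J hc hJ w hw hJw γ hγ'⟩

include hc hJ hJd in
/-- **The `ht` input of ★ `OrbitalMeasureFamily.exists_isCanonical` on `U(J)(F_v)`**: at every `γ` regular semisimple in `GL_N(E ⊗_F F_v)` the centraliser carries a
Haar measure, inversion invariant, with mass `1` on its compact core (★ `exists_isHaarMeasure_compactCore_eq_one` on the facts above; `Z(γ)` is closed in the locally
compact `U(J)(F_v)`). [cite: Rogawski1990, §4.3 (4.3.1) p. 43] [cite: Tits1979, §3.9] -/
theorem forall_isRegularElt_exists_isHaarMeasure_compactCore_centralizer_local_eq_one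
    [MeasurableSpace («local» E c N J v)] [BorelSpace («local» E c N J v)] :
    ∀ γ : «local» E c N J v, IsRegularElt (γ : GL (Fin N) (LocalRing E v)) →
      ∃ t : Measure (Subgroup.centralizer ({γ} : Set («local» E c N J v))),
        t.IsHaarMeasure ∧ t.IsInvInvariant ∧ t (compactCore (Subgroup.centralizer ({γ} : Set («local» E c N J v)))) = 1 := by
  intro γ hγ
  obtain ⟨hcomm, hc', ho⟩ := compactCore_centralizer_local_facts_of_isRegularElt c N J hc hJ hJd γ hγ
  haveI : LocallyCompactSpace (Subgroup.centralizer ({γ} : Set («local» E c N J v))) :=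
    (isClosed_coe_centralizer_singleton γ).isClosedEmbedding_subtypeVal.locallyCompactSpace
  exact exists_isHaarMeasure_compactCore_eq_one hcomm hc' ho

end Local

/-- **Every element of `GL₁(R)` is regular semisimple**: its characteristic polynomial `X − a` is separable (`Polynomial.separable_X_sub_C`).
[cite: Rogawski1990, §3.1 p. 19] -/
theorem isRegularElt_of_fin_one {R : Type*} [CommRing R] (g : GL (Fin 1) R) : IsRegularElt g := by
  rw [isRegularElt_iff, Matrix.charpoly, Matrix.det_fin_one, Matrix.charmatrix_apply_eq]
  exact Polynomial.separable_X_sub_C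

end Literature.NumberTheory.Automorphic.UnitaryGroup

/-! ## §2 The CM producers: `G′_v = U(H′)(L⁺_v)`, `H_v = U(Φ₂)(L⁺_v) × U(Φ₁)(L⁺_v)`, and the pair -/

namespace Literature.NumberTheory.Rogawski1990

open Literature.NumberTheory.Automorphic Literature.NumberTheory.Automorphic.UnitaryGroup

section CMG

variable (L : Type) [Field L] [NumberField L] [IsCMField L] (H' : Matrix (Fin 3) (Fin 3) L)
  (hH' : (H'.map (IsCMField.complexConj L))ᵀ = H') (hH'd : IsUnit H'.det)
  (v : HeightOneSpectrum (𝓞 ↥(maximalRealSubfield L)))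
  [MeasurableSpace ((UnitaryGroup.cmDatum L 3 H').Local v)] [BorelSpace ((UnitaryGroup.cmDatum L 3 H').Local v)]
  [∀ γ : (UnitaryGroup.cmDatum L 3 H').Local v,
    MeasurableSpace ((UnitaryGroup.cmDatum L 3 H').Local v ⧸ Subgroup.centralizer ({γ} : Set ((UnitaryGroup.cmDatum L 3 H').Local v)))]
  [∀ γ : (UnitaryGroup.cmDatum L 3 H').Local v,
    BorelSpace ((UnitaryGroup.cmDatum L 3 H').Local v ⧸ Subgroup.centralizer ({γ} : Set ((UnitaryGroup.cmDatum L 3 H').Local v)))]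
  (νG : Measure ((UnitaryGroup.cmDatum L 3 H').Local v)) [νG.IsHaarMeasure] [νG.IsMulRightInvariant]

include hH' hH'd in
/-- **CANONICAL FAMILIES EXIST on `G′_v = U(H′)(L⁺_v)`** for the regular semisimple classes (★ `LocalTransferExplicit`'s `P := fun γ => IsRegularElt γ.val`) and any
Haar measure `νG`, `H′` hermitian with unit determinant: ★ `OrbitalMeasureFamily.exists_isCanonical` fed by §1 at `J := H′` (the `cmDatum` carrier IS `«local»`,
★ `cmDatum_Local`). [cite: Rogawski1990, §4.3 (4.3.1) p. 43; §4.9 Prop. 4.9.1 (a) p. 55] [cite: Tits1979, §3.9] -/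
theorem exists_isCanonical_cmDatum_local :
    ∃ mG : OrbitalMeasureFamily ((UnitaryGroup.cmDatum L 3 H').Local v),
      mG.IsCanonical (fun γ => IsRegularElt (γ.val : GL (Fin 3) (UnitaryGroup.LocalRing L v))) νG := by
  -- the `cmDatum` carrier IS `↥(«local» …)` (★ `cmDatum_Local`, definitional): hand its σ-algebra to the matrix carrier
  letI : MeasurableSpace («local» L (IsCMField.complexConj L) 3 H' v) := ‹MeasurableSpace ((UnitaryGroup.cmDatum L 3 H').Local v)›
  haveI : BorelSpace («local» L (IsCMField.complexConj L) 3 H' v) := ‹BorelSpace ((UnitaryGroup.cmDatum L 3 H').Local v)›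
  exact OrbitalMeasureFamily.exists_isCanonical _ νG
    (forall_isRegularElt_exists_isHaarMeasure_compactCore_centralizer_local_eq_one (IsCMField.complexConj L) 3 H'
      (IsCMField.complexConj_ne_one L) hH' hH'd)

end CMG

section CMH

variable (L : Type) [Field L] [NumberField L] [IsCMField L] (v : HeightOneSpectrum (𝓞 ↥(maximalRealSubfield L)))
  [MeasurableSpace ((UnitaryGroup.cmDatum L 2 (Matrix.of fun i j : Fin 2 => if i.val + j.val + 1 = 2 then (1 : L) else 0)).Local v ×
    (UnitaryGroup.cmDatum L 1 (Matrix.of fun i j : Fin 1 => if i.val + j.val + 1 = 1 then (1 : L) else 0)).Local v)]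
  [BorelSpace ((UnitaryGroup.cmDatum L 2 (Matrix.of fun i j : Fin 2 => if i.val + j.val + 1 = 2 then (1 : L) else 0)).Local v ×
    (UnitaryGroup.cmDatum L 1 (Matrix.of fun i j : Fin 1 => if i.val + j.val + 1 = 1 then (1 : L) else 0)).Local v)]
  [∀ a : ((UnitaryGroup.cmDatum L 2 (Matrix.of fun i j : Fin 2 => if i.val + j.val + 1 = 2 then (1 : L) else 0)).Local v ×
      (UnitaryGroup.cmDatum L 1 (Matrix.of fun i j : Fin 1 => if i.val + j.val + 1 = 1 then (1 : L) else 0)).Local v),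
    MeasurableSpace (((UnitaryGroup.cmDatum L 2 (Matrix.of fun i j : Fin 2 => if i.val + j.val + 1 = 2 then (1 : L) else 0)).Local v ×
      (UnitaryGroup.cmDatum L 1 (Matrix.of fun i j : Fin 1 => if i.val + j.val + 1 = 1 then (1 : L) else 0)).Local v) ⧸
      Subgroup.centralizer ({a} : Set ((UnitaryGroup.cmDatum L 2 (Matrix.of fun i j : Fin 2 => if i.val + j.val + 1 = 2 then (1 : L) else 0)).Local v ×
      (UnitaryGroup.cmDatum L 1 (Matrix.of fun i j : Fin 1 => if i.val + j.val + 1 = 1 then (1 : L) else 0)).Local v)))]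
  [∀ a : ((UnitaryGroup.cmDatum L 2 (Matrix.of fun i j : Fin 2 => if i.val + j.val + 1 = 2 then (1 : L) else 0)).Local v ×
      (UnitaryGroup.cmDatum L 1 (Matrix.of fun i j : Fin 1 => if i.val + j.val + 1 = 1 then (1 : L) else 0)).Local v),
    BorelSpace (((UnitaryGroup.cmDatum L 2 (Matrix.of fun i j : Fin 2 => if i.val + j.val + 1 = 2 then (1 : L) else 0)).Local v ×
      (UnitaryGroup.cmDatum L 1 (Matrix.of fun i j : Fin 1 => if i.val + j.val + 1 = 1 then (1 : L) else 0)).Local v) ⧸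
      Subgroup.centralizer ({a} : Set ((UnitaryGroup.cmDatum L 2 (Matrix.of fun i j : Fin 2 => if i.val + j.val + 1 = 2 then (1 : L) else 0)).Local v ×
      (UnitaryGroup.cmDatum L 1 (Matrix.of fun i j : Fin 1 => if i.val + j.val + 1 = 1 then (1 : L) else 0)).Local v)))]
  (νH : Measure ((UnitaryGroup.cmDatum L 2 (Matrix.of fun i j : Fin 2 => if i.val + j.val + 1 = 2 then (1 : L) else 0)).Local v ×
    (UnitaryGroup.cmDatum L 1 (Matrix.of fun i j : Fin 1 => if i.val + j.val + 1 = 1 then (1 : L) else 0)).Local v))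
  [νH.IsHaarMeasure] [νH.IsMulRightInvariant]

/-- **CANONICAL FAMILIES EXIST on `H_v = U(Φ₂)(L⁺_v) × U(Φ₁)(L⁺_v)`** for the `G`-regular classes (★ `IsLocalGRegular L v`) and any Haar measure `νH`: at
`γ_H = (γ₂, γ₁)` `G`-regular, `γ₂` is regular semisimple (★ `coe_endoEmbLocal`, ★ `charpoly_endoGL`: a separable product has separable factors — the
pattern of ★ `IsGRegular.isRegularElt_fst`) and so is `γ₁ ∈ GL₁` (`isRegularElt_of_fin_one`); §1 on both
factors (`Φ_n` is `c`-hermitian with unit determinant, ★ `antidiagOne_map_transpose`, ★ `isUnit_placeForm_antidiagOne`-pattern via `Matrix.det` of the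
permutation form) and ★ `exists_isHaarMeasure_compactCore_centralizer_prod_eq_one` give the torus measure on `Z(γ_H) = Z(γ₂) × Z(γ₁)`.
[cite: Rogawski1990, §4.3 (4.3.1) p. 43; §4.9 Prop. 4.9.1 (a) p. 55] [cite: Tits1979, §3.9] -/
theorem exists_isCanonical_H_local :
    ∃ mH : OrbitalMeasureFamily ((UnitaryGroup.cmDatum L 2 (Matrix.of fun i j : Fin 2 => if i.val + j.val + 1 = 2 then (1 : L) else 0)).Local v ×
        (UnitaryGroup.cmDatum L 1 (Matrix.of fun i j : Fin 1 => if i.val + j.val + 1 = 1 then (1 : L) else 0)).Local v),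
      mH.IsCanonical (IsLocalGRegular L v) νH := by
  have hΦ₂ := antidiagOne_map_transpose (IsCMField.complexConj L) 2
  have hΦ₁ := antidiagOne_map_transpose (IsCMField.complexConj L) 1
  have hΦ₂d : IsUnit (Matrix.of fun i j : Fin 2 => if i.val + j.val + 1 = 2 then (1 : L) else 0).det := by
    have h : (Matrix.of fun i j : Fin 2 => if i.val + j.val + 1 = 2 then (1 : L) else 0) = !![0, 1; 1, 0] := by
      ext i j; fin_cases i <;> fin_cases j <;> rfl
    rw [h, Matrix.det_fin_two_of]; norm_num
  have hΦ₁d : IsUnit (Matrix.of fun i j : Fin 1 => if i.val + j.val + 1 = 1 then (1 : L) else 0).det := by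
    rw [Matrix.det_fin_one, Matrix.of_apply]; norm_num
  refine OrbitalMeasureFamily.exists_isCanonical _ νH fun γH hγH => ?_
  obtain ⟨γ₂, γ₁⟩ := γH
  -- `G`-regularity of `(γ₂, γ₁)` is regularity of `ι_v(γ₂, γ₁) = endoGL(γ₂, γ₁)` (★ `coe_endoEmbLocal`), whose characteristic polynomial is the
  -- product (★ `charpoly_endoGL`); a separable product has separable factors
  have h3 : IsRegularElt ((endoEmbLocal L v (γ₂, γ₁)).val : GL (Fin 3) (UnitaryGroup.LocalRing L v)) := hγH
  rw [isRegularElt_iff, coe_endoEmbLocal, charpoly_endoGL] at h3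
  have h₂ : IsRegularElt (γ₂.val : GL (Fin 2) (UnitaryGroup.LocalRing L v)) := h3.of_mul_left
  have h₁ : IsRegularElt (γ₁.val : GL (Fin 1) (UnitaryGroup.LocalRing L v)) := isRegularElt_of_fin_one _
  -- pin the factor carriers to the `cmDatum` spellings (so every instance is the letter's), then feed §1 on `«local»` (definitionally the same types)
  refine exists_isHaarMeasure_compactCore_centralizer_prod_eq_one
    (A := (UnitaryGroup.cmDatum L 2 (Matrix.of fun i j : Fin 2 => if i.val + j.val + 1 = 2 then (1 : L) else 0)).Local v)
    (B := (UnitaryGroup.cmDatum L 1 (Matrix.of fun i j : Fin 1 => if i.val + j.val + 1 = 1 then (1 : L) else 0)).Local v)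
    γ₂ γ₁ ?_ ?_ ?_ ?_ ?_ ?_
  · exact (compactCore_centralizer_local_facts_of_isRegularElt (IsCMField.complexConj L) 2 _ (IsCMField.complexConj_ne_one L) hΦ₂ hΦ₂d γ₂ h₂).1
  · exact (compactCore_centralizer_local_facts_of_isRegularElt (IsCMField.complexConj L) 1 _ (IsCMField.complexConj_ne_one L) hΦ₁ hΦ₁d γ₁ h₁).1
  · exact (compactCore_centralizer_local_facts_of_isRegularElt (IsCMField.complexConj L) 2 _ (IsCMField.complexConj_ne_one L) hΦ₂ hΦ₂d γ₂ h₂).2.1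
  · exact (compactCore_centralizer_local_facts_of_isRegularElt (IsCMField.complexConj L) 2 _ (IsCMField.complexConj_ne_one L) hΦ₂ hΦ₂d γ₂ h₂).2.2
  · exact (compactCore_centralizer_local_facts_of_isRegularElt (IsCMField.complexConj L) 1 _ (IsCMField.complexConj_ne_one L) hΦ₁ hΦ₁d γ₁ h₁).2.1
  · exact (compactCore_centralizer_local_facts_of_isRegularElt (IsCMField.complexConj L) 1 _ (IsCMField.complexConj_ne_one L) hΦ₁ hΦ₁d γ₁ h₁).2.2

end CMH

section CMPair

variable (L : Type) [Field L] [NumberField L] [IsCMField L] (H' : Matrix (Fin 3) (Fin 3) L)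
  (hH' : (H'.map (IsCMField.complexConj L))ᵀ = H') (hH'd : IsUnit H'.det)
  (v : HeightOneSpectrum (𝓞 ↥(maximalRealSubfield L)))
  [MeasurableSpace ((UnitaryGroup.cmDatum L 3 H').Local v)] [BorelSpace ((UnitaryGroup.cmDatum L 3 H').Local v)]
  [∀ γ : (UnitaryGroup.cmDatum L 3 H').Local v,
    MeasurableSpace ((UnitaryGroup.cmDatum L 3 H').Local v ⧸ Subgroup.centralizer ({γ} : Set ((UnitaryGroup.cmDatum L 3 H').Local v)))]
  [∀ γ : (UnitaryGroup.cmDatum L 3 H').Local v,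
    BorelSpace ((UnitaryGroup.cmDatum L 3 H').Local v ⧸ Subgroup.centralizer ({γ} : Set ((UnitaryGroup.cmDatum L 3 H').Local v)))]
  [MeasurableSpace ((UnitaryGroup.cmDatum L 2 (Matrix.of fun i j : Fin 2 => if i.val + j.val + 1 = 2 then (1 : L) else 0)).Local v ×
    (UnitaryGroup.cmDatum L 1 (Matrix.of fun i j : Fin 1 => if i.val + j.val + 1 = 1 then (1 : L) else 0)).Local v)]
  [BorelSpace ((UnitaryGroup.cmDatum L 2 (Matrix.of fun i j : Fin 2 => if i.val + j.val + 1 = 2 then (1 : L) else 0)).Local v ×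
    (UnitaryGroup.cmDatum L 1 (Matrix.of fun i j : Fin 1 => if i.val + j.val + 1 = 1 then (1 : L) else 0)).Local v)]
  [∀ a : ((UnitaryGroup.cmDatum L 2 (Matrix.of fun i j : Fin 2 => if i.val + j.val + 1 = 2 then (1 : L) else 0)).Local v ×
      (UnitaryGroup.cmDatum L 1 (Matrix.of fun i j : Fin 1 => if i.val + j.val + 1 = 1 then (1 : L) else 0)).Local v),
    MeasurableSpace (((UnitaryGroup.cmDatum L 2 (Matrix.of fun i j : Fin 2 => if i.val + j.val + 1 = 2 then (1 : L) else 0)).Local v ×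
      (UnitaryGroup.cmDatum L 1 (Matrix.of fun i j : Fin 1 => if i.val + j.val + 1 = 1 then (1 : L) else 0)).Local v) ⧸
      Subgroup.centralizer ({a} : Set ((UnitaryGroup.cmDatum L 2 (Matrix.of fun i j : Fin 2 => if i.val + j.val + 1 = 2 then (1 : L) else 0)).Local v ×
      (UnitaryGroup.cmDatum L 1 (Matrix.of fun i j : Fin 1 => if i.val + j.val + 1 = 1 then (1 : L) else 0)).Local v)))]
  [∀ a : ((UnitaryGroup.cmDatum L 2 (Matrix.of fun i j : Fin 2 => if i.val + j.val + 1 = 2 then (1 : L) else 0)).Local v ×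
      (UnitaryGroup.cmDatum L 1 (Matrix.of fun i j : Fin 1 => if i.val + j.val + 1 = 1 then (1 : L) else 0)).Local v),
    BorelSpace (((UnitaryGroup.cmDatum L 2 (Matrix.of fun i j : Fin 2 => if i.val + j.val + 1 = 2 then (1 : L) else 0)).Local v ×
      (UnitaryGroup.cmDatum L 1 (Matrix.of fun i j : Fin 1 => if i.val + j.val + 1 = 1 then (1 : L) else 0)).Local v) ⧸
      Subgroup.centralizer ({a} : Set ((UnitaryGroup.cmDatum L 2 (Matrix.of fun i j : Fin 2 => if i.val + j.val + 1 = 2 then (1 : L) else 0)).Local v ×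
      (UnitaryGroup.cmDatum L 1 (Matrix.of fun i j : Fin 1 => if i.val + j.val + 1 = 1 then (1 : L) else 0)).Local v)))]
  (νH : Measure ((UnitaryGroup.cmDatum L 2 (Matrix.of fun i j : Fin 2 => if i.val + j.val + 1 = 2 then (1 : L) else 0)).Local v ×
    (UnitaryGroup.cmDatum L 1 (Matrix.of fun i j : Fin 1 => if i.val + j.val + 1 = 1 then (1 : L) else 0)).Local v))
  (νG : Measure ((UnitaryGroup.cmDatum L 3 H').Local v))
  [νH.IsHaarMeasure] [νH.IsMulRightInvariant] [νG.IsHaarMeasure] [νG.IsMulRightInvariant]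

include hH' hH'd in
/-- **THE PAIR**: at every finite place `v` there are canonical families `(mH, mG)` on `H_v` and `G′_v` for the Haar measures `(νH, νG)` — literally the `∃ mH mG`
prefix of ★ `LocalTransferExplicit` (:82) with its two `IsCanonical` clauses, for `obtain ⟨mH, mG, hmH, hmG⟩` in (J5) ∕ B5-A. [cite: Rogawski1990, §4.9 Prop. 4.9.1 (a) p. 55;
§4.3 (4.3.1) p. 43] -/
theorem exists_isCanonical_pair :
    ∃ (mH : OrbitalMeasureFamily ((UnitaryGroup.cmDatum L 2 (Matrix.of fun i j : Fin 2 => if i.val + j.val + 1 = 2 then (1 : L) else 0)).Local v ×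
        (UnitaryGroup.cmDatum L 1 (Matrix.of fun i j : Fin 1 => if i.val + j.val + 1 = 1 then (1 : L) else 0)).Local v))
      (mG : OrbitalMeasureFamily ((UnitaryGroup.cmDatum L 3 H').Local v)),
      mH.IsCanonical (IsLocalGRegular L v) νH ∧
        mG.IsCanonical (fun γ => IsRegularElt (γ.val : GL (Fin 3) (UnitaryGroup.LocalRing L v))) νG := by
  obtain ⟨mH, hmH⟩ := exists_isCanonical_H_local L v νH
  obtain ⟨mG, hmG⟩ := exists_isCanonical_cmDatum_local L H' hH' hH'd v νG
  exact ⟨mH, mG, hmH, hmG⟩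

end CMPair

end Literature.NumberTheory.Rogawski1990

end
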